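import Summits.Ventures.CertifiedManyBodySolver.Theses.CovNdNiO2M21
import Summits.Ventures.CertifiedManyBodySolver.Observables.RungLeavesCoverageNdNiO2ResidualDensityBundlesCaps
import Summits.Ventures.CertifiedManyBodySolver.Certificates.HubbardSquare_NdBoxE_n477o500_bundleAP_pin_j314087
import Summits.Ventures.CertifiedManyBodySolver.Certificates.HubbardSquare_NdBoxE_n477o500_bundleBP_pin_j313367
import Summits.Ventures.CertifiedManyBodySolver.Downfold.BoxesNdNiO2M21QRowsKinematic
import HarnessLib
import HarnessLib.Audit

/-!
# Ventures/CertifiedManyBodySolver — Theorems/CovNdNiO2M21ResidualHighUSlab.lean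

HONEST FRAMING: the route item `Theses.CovNdNiO2M21.ResidualHighUSlab` (stmt-Ventures-26752, route-Ventures-CovNdNiO2M21) **CLOSED MODULO CLAIM NODES** — ONE `exact` on
hubbard-cov-ndnio2-unc-3's parametric closer `ndM21_residualHighUSlab_of_bundleRowsWN_capTables` (p629921) fed with the 2 boxdual BUNDLE claim
node(s) named below for the P = −X₀(−23/50) rows (CANDIDATE of one lineage until the second-reader / referee legs) and the KINEMATIC (state-free, hypothesis-free) theorem `Downfold.ndM21_QRowWN_kinematic` (hubbard-cov-la214-box-2, p636407 — the object of record, captain D17/D17b) for the 2 Q = −X₀(−11/25) rows;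
cap tables = the node-free station-5 chord caps `ndBoxE_station5_afChordCap_segA/segBC` (hubbard-cov-ndnio2-unc-1 p628541) — NO cap node at all;
floors node-free (band bottom); every side condition a `norm_num` fact. The item does NOT close `proved` while the nodes are claims (captain D10 / route-pen protocol (α′) of the
sister route CovLa214M2b: HELD «closed modulo nodes»). One-sided certified stiffness CEILINGS on a SCREENING-GRADE downfolded box «box ⊂ NdNiO₂ PARENT (M21, film not
superconducting)» = CONTROL / CALIBRATION (class (xx1)) + labelled heuristic; a ceiling never speaks to the presence or absence of superconductivity; no `T_c` / phase sentence;
never «certified true negative / positive»; no summit statement is proved here. Seat `hubbard-cov-ndnio2-box-1` (g1; generator `tools/emit_nd.py closer`); zero compute.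
NUMBER: common ceiling c := 4779578/10⁷ = the item's bar (`hc := le_rfl`; every end price is tested against the bar itself, unc-3 g3 review / captain CONCUR); largest P-row end price (7-dp UP) = 4741419/10000000 (margin 0.0038159); the kinematic Q rows price 0.4768946 / 0.4668471 (`ndM21_QRowWN_kinematic_prices_bar`).
References: T. Koma, H. Tasaki, J. Stat. Phys. 76 (1994) 745, §1 [KomaTasaki1994]; D. J. Scalapino, S. R. White, S.-C. Zhang, PRB 47 (1993) 7995, §II [ScalapinoWhiteZhang1993].
-/

noncomputable section

namespace Summit.Ventures.CertifiedManyBodySolver.Theorems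

open Summit.Ventures.CertifiedManyBodySolver.Observables Summit.Ventures.CertifiedManyBodySolver.Certificates
open Summit.Ventures.CertifiedManyBodySolver.Downfold
open Literature.MathematicalPhysics.QuantumLattice Literature.MathematicalPhysics.QuantumLattice.ThermodynamicLimit

/-- **`ResidualHighUSlab` CLOSED MODULO NODES** (AF cap key; c := the bar 4779578/10⁷, largest P end price 4741419/10000000): the 2 P-row bundle claim node(s) + the kinematic Q rows ⇒ the route decl, by
`ndM21_residualHighUSlab_of_bundleRowsWN_capTables`. [cite: KomaTasaki1994, §1] [cite: ScalapinoWhiteZhang1993, §II] -/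
theorem covNdNiO2M21_ResidualHighUSlab_of_bundleNodes_AF
    (hPA : cert_ndBoxE_n477o500_bundleA_om23o50_AF_j314087_wn)
    (hPB : cert_ndBoxE_n477o500_bundleB_om23o50_AF_e1_j313367_wn) :
    Summit.Ventures.CertifiedManyBodySolver.Theses.CovNdNiO2M21.ResidualHighUSlab := by
  unfold Summit.Ventures.CertifiedManyBodySolver.Theses.CovNdNiO2M21.ResidualHighUSlab
  exact ndM21_residualHighUSlab_of_bundleRowsWN_capTables (c := 4779578 / 10000000) hPA (Summit.Ventures.CertifiedManyBodySolver.Downfold.ndM21_QRowWN_kinematic 5 (-276 / 425) (-11 / 20) (-131652 / 53125) (-7164236581 / 10000000000) 5) (hPB.toWN (by norm_num)) (Summit.Ventures.CertifiedManyBodySolver.Downfold.ndM21_QRowWN_kinematic 5 (-11 / 20) (-23 / 50) (-5247 / 2500) (-884698123 / 1250000000) 5)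
    (by norm_num) (by norm_num) (by norm_num) (by norm_num)
    ndBoxE_station5_afChordCap_segA ndBoxE_station5_afChordCap_segBC
    (by norm_num) (by norm_num) (by norm_num) (by norm_num) (by norm_num) (by norm_num)
    (by norm_num) (by norm_num) (by norm_num) (by norm_num)
    (by norm_num) (by norm_num) (by norm_num) (by norm_num)
    ⟨by norm_num, by norm_num, by norm_num⟩ Summit.Ventures.CertifiedManyBodySolver.Downfold.ndM21_QRowWN_kinematic_prices_bar ⟨by norm_num, by norm_num, by norm_num⟩ Summit.Ventures.CertifiedManyBodySolver.Downfold.ndM21_QRowWN_kinematic_prices_bar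
    le_rfl

end Summit.Ventures.CertifiedManyBodySolver.Theorems

end

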